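import Summits.Ventures.Crystal3D.Theorems.StickyWulffConstantCoaxialWallLawWordStep
import Summits.Ventures.Crystal3D.Theorems.StickyWulffConstantCoaxialWallLawEndRowDefs
import HarnessLib

/-!
# The word automaton at every version (v1/v2): every move — NARROW included — lands on a certified state

HONEST FRAMING. Venture `Summits/Ventures/Crystal3D` (cell `crystal3d-full`), helper `--supports` the crux
`CoaxialWallLaw` of `route-Ventures-StickyWulffConstant` (REGISTERED line `WallLedgerF`).  Rung credit; F-C1 not
moved; no census, membership facts only.  cf-p1 g28 (xxxviii″): version-parametric re-landing of `word_move_target`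
(`…WordStep`) with the move clauses in the typed vocabulary of `…EndRowDefs`:

* `triangle_after_narrow` — from a ball `y ∈ X` whose POSITIVE TRIPLE for a menu normal `m` of `G` is occupied,
  along a far slot `u` (`⟪G u, m⟫ = √(2/3)`): the face `{−u, u′ − u, u″ − u}` of the far triple certifies the target
  (the proof of `triangle_after_full_step` uses nothing else of the full shell);
* **`word_move_target_gen`** — for a certified state `v ∈ W` that is `ver`-moving (FULL / twin-dozen CROSS or
  GLIDE / NARROW under `v2`), the target `f v` is certified, its predecessor ball is `v.1`, at distance `1`.
WHAT THIS IS NOT: counting and exports are the next files; F-C1 not moved.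
-/

noncomputable section

namespace Summit.Ventures.Crystal3D.Theorems

open Summit.Ventures.Crystal3D Finset
open Literature.MathematicalPhysics.StatisticalMechanics (fccStacking)
open scoped InnerProductSpace

variable {X : Finset (EuclideanSpace ℝ (Fin 3))}

/-- **Triangle after a NARROW straight move.**  See the module docstring. -/
theorem triangle_after_narrow (G : EuclideanSpace ℝ (Fin 3) ≃ₗᵢ[ℝ] EuclideanSpace ℝ (Fin 3))
    {m : EuclideanSpace ℝ (Fin 3)} (hm : ‖m‖ = 1)
    (hmenu : ∀ w ∈ fccSlots, ⟪G w, m⟫_ℝ = 0 ∨ ⟪G w, m⟫_ℝ = Real.sqrt (2 / 3) ∨ ⟪G w, m⟫_ℝ = -Real.sqrt (2 / 3))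
    {y : EuclideanSpace ℝ (Fin 3)} (hy : y ∈ X) (hpos : ∀ w ∈ fccSlots, 0 < ⟪G w, m⟫_ℝ → y + G w ∈ X)
    {u : EuclideanSpace ℝ (Fin 3)} (hu : u ∈ fccSlots) (hum : ⟪G u, m⟫_ℝ = Real.sqrt (2 / 3)) :
    ∃ a ∈ fccSlots, ∃ b ∈ fccSlots, ∃ c ∈ fccSlots,
      ⟪a, b⟫_ℝ = 1 / 2 ∧ ⟪a, c⟫_ℝ = 1 / 2 ∧ ⟪b, c⟫_ℝ = 1 / 2 ∧
      y + G u + G a ∈ X ∧ y + G u + G b ∈ X ∧ y + G u + G c ∈ X := by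
  have hr : 0 < Real.sqrt (2 / 3) := Real.sqrt_pos.2 (by norm_num)
  obtain ⟨u₁, hu₁, u₂, hu₂, u₃, hu₃, hn₁, hn₂, hn₃, i12, i13, i23, -, hcover⟩ := exists_far_frame G hm hmenu
  -- reorder the far triple so that `u` comes first
  obtain ⟨v₂, hv₂, v₃, hv₃, hv₂m, hv₃m, j12, j13, j23⟩ : ∃ v₂ ∈ fccSlots, ∃ v₃ ∈ fccSlots,
      ⟪G v₂, m⟫_ℝ = Real.sqrt (2 / 3) ∧ ⟪G v₃, m⟫_ℝ = Real.sqrt (2 / 3) ∧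
      ⟪u, v₂⟫_ℝ = 1 / 2 ∧ ⟪u, v₃⟫_ℝ = 1 / 2 ∧ ⟪v₂, v₃⟫_ℝ = 1 / 2 := by
    rcases hcover u hu (by rw [hum]; exact hr) with rfl | rfl | rfl
    · exact ⟨u₂, hu₂, u₃, hu₃, hn₂, hn₃, i12, i13, i23⟩
    · exact ⟨u₁, hu₁, u₃, hu₃, hn₁, hn₃, by rw [real_inner_comm]; exact i12, i23, i13⟩
    · exact ⟨u₁, hu₁, u₂, hu₂, hn₁, hn₂, by rw [real_inner_comm]; exact i13,
        by rw [real_inner_comm]; exact i23, i12⟩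
  obtain ⟨⟨ha, hb, hc⟩, iab, iac, ibc⟩ := face_triangle hu hv₂ hv₃ j12 j13 j23
  refine ⟨-u, ha, v₂ - u, hb, v₃ - u, hc, iab, iac, ibc, ?_, ?_, ?_⟩
  · rw [map_neg, add_neg_cancel_right]; exact hy
  · rw [map_sub, add_add_sub_cancel]; exact hpos v₂ hv₂ (by rw [hv₂m]; exact hr)
  · rw [map_sub, add_add_sub_cancel]; exact hpos v₃ hv₃ (by rw [hv₃m]; exact hr)

section Step

variable {K : Type*} {F : K → (EuclideanSpace ℝ (Fin 3) ≃ₗᵢ[ℝ] EuclideanSpace ℝ (Fin 3))}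
  {d : K → EuclideanSpace ℝ (Fin 3)} {next : K → EuclideanSpace ℝ (Fin 3) → K}
  {W : Finset (EuclideanSpace ℝ (Fin 3) × K)}
  {f : EuclideanSpace ℝ (Fin 3) × K → EuclideanSpace ℝ (Fin 3) × K}

/-- **A move lands on a certified state one unit away — every version.**  See the module docstring.  `W` is the
set of certified states (membership iff: ball in `X`, triangle certificate, predecessor ball in `X`). -/
theorem word_move_target_gen (ver : WordVersion)
    (hd : ∀ κ, ∃ u ∈ fccSlots, d κ = F κ u)
    (hdn : ∀ κ, ∃ m : EuclideanSpace ℝ (Fin 3), ‖m‖ = 1 ∧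
      (∀ w ∈ fccSlots, ⟪F κ w, m⟫_ℝ = 0 ∨ ⟪F κ w, m⟫_ℝ = Real.sqrt (2 / 3) ∨ ⟪F κ w, m⟫_ℝ = -Real.sqrt (2 / 3)) ∧
      ⟪d κ, m⟫_ℝ = Real.sqrt (2 / 3))
    (hmirror : ∀ κ (m : EuclideanSpace ℝ (Fin 3)), ‖m‖ = 1 →
      (∀ w ∈ fccSlots, ⟪F κ w, m⟫_ℝ = 0 ∨ ⟪F κ w, m⟫_ℝ = Real.sqrt (2 / 3) ∨ ⟪F κ w, m⟫_ℝ = -Real.sqrt (2 / 3)) →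
      ⟪d κ, m⟫_ℝ = Real.sqrt (2 / 3) → ∀ x, F (next κ m) x = F κ x - (2 * ⟪F κ x, m⟫_ℝ) • m)
    (hdnext : ∀ κ (m : EuclideanSpace ℝ (Fin 3)), ‖m‖ = 1 →
      (∀ w ∈ fccSlots, ⟪F κ w, m⟫_ℝ = 0 ∨ ⟪F κ w, m⟫_ℝ = Real.sqrt (2 / 3) ∨ ⟪F κ w, m⟫_ℝ = -Real.sqrt (2 / 3)) →
      ⟪d κ, m⟫_ℝ = Real.sqrt (2 / 3) → ⟪d (next κ m), m⟫_ℝ = Real.sqrt (2 / 3))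
    (hW : ∀ v, v ∈ W ↔ (v.1 ∈ X ∧
      (∃ a ∈ fccSlots, ∃ a' ∈ fccSlots, ∃ a'' ∈ fccSlots,
        ⟪a, a'⟫_ℝ = 1 / 2 ∧ ⟪a, a''⟫_ℝ = 1 / 2 ∧ ⟪a', a''⟫_ℝ = 1 / 2 ∧
        v.1 + F v.2 a ∈ X ∧ v.1 + F v.2 a' ∈ X ∧ v.1 + F v.2 a'' ∈ X) ∧
      v.1 - d v.2 ∈ X))
    (hf_full : ∀ v ∈ W, IsFull X (F v.2) v.1 → f v = (v.1 + d v.2, v.2))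
    (hf_cross : ∀ v ∈ W, ∀ m : EuclideanSpace ℝ (Fin 3), IsTwinReading X (F v.2) m v.1 →
      ⟪d v.2, m⟫_ℝ = Real.sqrt (2 / 3) → f v = (v.1 + d (next v.2 m), next v.2 m))
    (hf_glide : ∀ v ∈ W, ∀ m : EuclideanSpace ℝ (Fin 3), IsTwinReading X (F v.2) m v.1 →
      ⟪d v.2, m⟫_ℝ = 0 → f v = (v.1 + d v.2, v.2))
    (hf_narrow : ∀ v ∈ W, ver = WordVersion.v2 → IsNarrow X (F v.2) (d v.2) v.1 → f v = (v.1 + d v.2, v.2))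
    {v : EuclideanSpace ℝ (Fin 3) × K} (hv : v ∈ W) (hmov : IsMoving X ver (F v.2) (d v.2) v.1) :
    f v ∈ W ∧ (f v).1 - d (f v).2 = v.1 ∧ dist v.1 (f v).1 = 1 := by
  have hr : 0 < Real.sqrt (2 / 3) := Real.sqrt_pos.2 (by norm_num)
  obtain ⟨hbX, -, -⟩ := (hW v).1 hv
  -- unit step along a vector `x = F κ' u`: the three conclusions from the target data
  have finish : ∀ (κ' : K) (x : EuclideanSpace ℝ (Fin 3)), f v = (v.1 + x, κ') → d κ' = x → ‖x‖ = 1 →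
      v.1 + x ∈ X →
      (∃ a ∈ fccSlots, ∃ a' ∈ fccSlots, ∃ a'' ∈ fccSlots,
        ⟪a, a'⟫_ℝ = 1 / 2 ∧ ⟪a, a''⟫_ℝ = 1 / 2 ∧ ⟪a', a''⟫_ℝ = 1 / 2 ∧
        v.1 + x + F κ' a ∈ X ∧ v.1 + x + F κ' a' ∈ X ∧ v.1 + x + F κ' a'' ∈ X) →
      f v ∈ W ∧ (f v).1 - d (f v).2 = v.1 ∧ dist v.1 (f v).1 = 1 := by
    intro κ' x hfv hdx hnx hxX htri
    rw [hfv]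
    refine ⟨(hW _).2 ⟨hxX, htri, ?_⟩, ?_, ?_⟩
    · show v.1 + x - d κ' ∈ X
      rw [hdx, add_sub_cancel_right]; exact hbX
    · show v.1 + x - d κ' = v.1
      rw [hdx, add_sub_cancel_right]
    · show dist v.1 (v.1 + x) = 1
      rw [dist_eq_norm, sub_add_cancel_left, norm_neg, hnx]
  obtain ⟨u, hu, hdu⟩ := hd v.2
  have hnd : ‖d v.2‖ = 1 := by rw [hdu, LinearIsometryEquiv.norm_map, norm_eq_one_of_mem_fccSlots hu]
  rcases hmov with hfull | ⟨m, htd, hdm⟩ | ⟨hver, hnar⟩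
  · -- full step
    obtain ⟨m, hm, hmenu, hdm⟩ := hdn v.2
    refine finish v.2 (d v.2) (hf_full v hv hfull) rfl hnd ?_ ?_
    · rw [hdu]; exact hfull u hu
    · rw [hdu]
      exact triangle_after_full_step (F v.2) hm hmenu hbX hfull hu (by rw [← hdu]; exact hdm)
  · obtain ⟨⟨hm, hmenu⟩, hown, hmir, hfar⟩ := htd
    rcases hdm with hdm | hdm
    · -- cross
      obtain ⟨u', hu', hdu'⟩ := hd (next v.2 m)
      have hFm := hmirror v.2 m hm hmenu hdm
      have hdm' := hdnext v.2 m hm hmenu hdm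
      have hneg : ⟪F v.2 u', m⟫_ℝ = -Real.sqrt (2 / 3) := by
        have h := hdm'
        rw [hdu', hFm, inner_sub_left, real_inner_smul_left, real_inner_self_eq_norm_sq, hm] at h
        linarith
      refine finish (next v.2 m) (d (next v.2 m)) (hf_cross v hv m ⟨⟨hm, hmenu⟩, hown, hmir, hfar⟩ hdm) rfl ?_ ?_ ?_
      · rw [hdu', LinearIsometryEquiv.norm_map, norm_eq_one_of_mem_fccSlots hu']
      · rw [hdu', hFm]; exact hmir u' hu' (by rw [hneg]; linarith)
      · rw [hdu']
        exact triangle_after_cross (F v.2) (F (next v.2 m)) hm hmenu hFm hbX hmir hu' (by rw [← hdu']; exact hdm')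
    · -- glide
      refine finish v.2 (d v.2) (hf_glide v hv m ⟨⟨hm, hmenu⟩, hown, hmir, hfar⟩ hdm) rfl hnd ?_ ?_
      · rw [hdu]; exact hown u hu (by rw [← hdu, hdm])
      · rw [hdu]
        exact triangle_after_glide (F v.2) hm hmenu hbX hown hu (by rw [← hdu]; exact hdm)
  · -- narrow (version `v2`)
    obtain ⟨htgt, m, ⟨hm, hmenu⟩, hdm, hpos⟩ := hnar
    refine finish v.2 (d v.2) (hf_narrow v hv hver ⟨htgt, m, ⟨hm, hmenu⟩, hdm, hpos⟩) rfl hnd htgt ?_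
    rw [hdu]
    exact triangle_after_narrow (F v.2) hm hmenu hbX hpos hu (by rw [← hdu]; exact hdm)

end Step

end Summit.Ventures.Crystal3D.Theorems

end
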